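import Summits.CriticalPhenomena.PercolationContinuityZ3.Theorems.PercAnnulusCrossingIICRecurrent
import Summits.CriticalPhenomena.PercolationContinuityZ3.Theorems.PercNecklaceBackboneNecklaceCofinalBridges
import HarnessLib

/-!
# Bottlenecks of the arm, VI: the cut-edges of an infinite cluster form a CHAIN — their finite pieces are strictly nested (lane RSW3, p1 gen 27)

builds on p205010 (kernel theorem, internal audit signed; external expert review pending) — NOT used in this file (deterministic graph
theory on any vertex type; the IIC corollary needs only `d ≥ 1`, `p > 0`).

RSW3 lane (LANE 3 `prim-rsw3`), seat `prim-rsw3-p1` (gen 27).  Helper file (`--supports stmt-CriticalPhenomena-4575`); no definitions,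
no sorries.  Memo `run/shared/lean/prim/rsw3/P1-QM.md` §40.

A CUT-EDGE of the cluster of `x` in `ω` is an edge `e` whose closing leaves `x` in a FINITE piece `F_e = C_{ω∖{e}}(x)` while `C_ω(x)` is
infinite (`…IICRecurrent`: Kesten's IIC has infinitely many, a.s.).  The finite pieces are TOTALLY ORDERED by inclusion and distinct
cut-edges have distinct pieces — the cut-edges form a chain `e₁ ≺ e₂ ≺ ⋯` ('string of beads'), each `e_k` lying inside `F_{e_{k+1}}`:

* `exists_crossing_of_mem_of_not_mem` — if `z ∈ C_η(x) ∖ C_{η∖{e}}(x)` then `e = {u, v}` is an edge of `η` with `u ∈ C_{η∖{e}}(x) ∌ v`,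
  `v ∈ C_η(x)` (finite analogue of `Necklace.exists_crossing`);
* **`cutPiece_subset_or_subset`** — the pieces of two cut-edges are nested;
* **`cutPiece_injective`** — distinct cut-edges have distinct pieces;
* `mem_cutPiece_of_not_subset` — if `F_e ⊄ F_{e'}`... equivalently if `F_{e'} ⊊ F_e` then both endpoints of `e'` lie in `F_e`;
* **`iicMeasure_ae_cutPieces_chain`** — for every IIC probability measure (`d ≥ 1`, `p > 0`): `ν`-a.s. the pieces of the cut-edges of the root
  form a strict chain.
References: R. Diestel, *Graph Theory* (2017) §1.4, §3.3 (blocks and bridges); H. Kesten, AIHP 22 (1986) (the backbone of the planar IIC);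
M. Heydenreich, R. van der Hofstad (2017) §15.3 ('the string of sausages').
-/

noncomputable section

namespace Summit.CriticalPhenomena.PercolationContinuityZ3.Theorems.Crossing

open MeasureTheory Filter Topology Literature.Probability.Percolation Literature.Probability.LatticeModels
open Literature.Probability.Percolation.DCT16
open Summit.CriticalPhenomena.PercolationContinuityZ3.Theorems.Necklace
open scoped Literature.Probability.Percolation ENNReal

/-! ## §1 Deterministic: crossing, nesting, injectivity -/

section Deterministic

variable {V : Type*}

/-- **Crossing lemma, finite form**: if `z ∈ C_η(x)` but `z ∉ C_{η∖{e}}(x)`, then `e = {u, v}` is an edge of `η` with `u ∈ C_{η∖{e}}(x)`,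
`v ∉ C_{η∖{e}}(x)` and `v ∈ C_η(x)` (otherwise `C_{η∖{e}}(x)` would be closed under `η`-adjacency). [cite: Diestel2017, §1.4] -/
theorem exists_crossing_of_mem_of_not_mem (η : BondConfig V) (e : Sym2 V) (x : V) {z : V} (hz : z ∈ openCluster η x)
    (hz' : z ∉ openCluster (η \ {e}) x) :
    ∃ u v : V, e = s(u, v) ∧ e ∈ η ∧ u ≠ v ∧ u ∈ openCluster (η \ {e}) x ∧ v ∉ openCluster (η \ {e}) x ∧ v ∈ openCluster η x := by
  by_contra hcon
  push Not at hcon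
  refine hz' (TwoGhost.openCluster_subset_of_closed (mem_openCluster_self _ _) ?_ hz)
  intro a ha c hac
  rw [openGraph_adj] at hac
  by_cases hb : s(a, c) = e
  · by_contra hc
    have hcη : c ∈ openCluster η x :=
      SimpleGraph.Reachable.trans (openCluster_mono Set.sdiff_subset x ha) ((openGraph_adj η a c).2 hac).reachable
    exact hcon a c hb.symm (hb ▸ hac.1) hac.2 ha hc hcη
  · have hadj : (openGraph (η \ {e})).Adj a c := (openGraph_adj _ _ _).2 ⟨⟨hac.1, hb⟩, hac.2⟩
    exact SimpleGraph.Reachable.trans ha hadj.reachable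

/-- **THE PIECES OF TWO CUT-EDGES ARE NESTED**: if `C_ω(x)` is infinite and `F_e = C_{ω∖{e}}(x)`, `F_{e'} = C_{ω∖{e'}}(x)` are both finite,
then `F_e ⊆ F_{e'}` or `F_{e'} ⊆ F_e`.  (If `F_e ⊄ F_{e'}`, the edge `e'` crosses inside `F_e`; with `e = {u,v}`, `v` outside `F_e`, the
infinite piece `C_{ω∖{e}}(v)` avoids `e'`, so it would join `F_{e'}` if `F_{e'}` met it.) [cite: Diestel2017, §3.3] -/
theorem cutPiece_subset_or_subset (ω : BondConfig V) (x : V) (hinf : (openCluster ω x).Infinite) {e e' : Sym2 V}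
    (he : (openCluster (ω \ {e}) x).Finite) (he' : (openCluster (ω \ {e'}) x).Finite) :
    openCluster (ω \ {e}) x ⊆ openCluster (ω \ {e'}) x ∨ openCluster (ω \ {e'}) x ⊆ openCluster (ω \ {e}) x := by
  by_contra h
  push Not at h
  obtain ⟨h1, h2⟩ := h
  rw [Set.not_subset] at h1 h2
  obtain ⟨z, hzF, hzF'⟩ := h1
  -- the crossing structure of `e`
  obtain ⟨u, v, heuv, heω, huv, hu, hv⟩ := exists_crossing ω e x hinf he
  have hsplit := openCluster_subset_union_of_crossing ω heuv hu
  have hFD : ∀ y, y ∈ openCluster (ω \ {e}) x → y ∈ openCluster (ω \ {e}) v → False :=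
    fun y hyF hyD => hv (SimpleGraph.Reachable.trans hyF (SimpleGraph.Reachable.symm hyD))
  -- `e'` crosses inside `F_e`: both endpoints of `e'` lie in `F_e`
  have hz2 : z ∉ openCluster ((ω \ {e}) \ {e'}) x := fun h' =>
    hzF' (openCluster_mono (Set.sdiff_subset_sdiff_left Set.sdiff_subset) x h')
  obtain ⟨u', v', he'uv, he'mem, -, hu', -, hv'⟩ := exists_crossing_of_mem_of_not_mem (ω \ {e}) e' x hzF hz2
  have hu'F : u' ∈ openCluster (ω \ {e}) x := openCluster_mono Set.sdiff_subset x hu'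
  -- the infinite piece `D = C_{ω∖e}(v)` avoids `e'`
  have hD : openCluster (ω \ {e}) v ⊆ openCluster ((ω \ {e}) \ {e'}) v := by
    refine TwoGhost.openCluster_subset_of_closed (mem_openCluster_self _ _) ?_
    intro a ha c hac
    rw [openGraph_adj] at hac
    by_cases hb : s(a, c) = e'
    · exfalso
      have haD : a ∈ openCluster (ω \ {e}) v := openCluster_mono Set.sdiff_subset v ha
      rw [he'uv, Sym2.eq_iff] at hb
      rcases hb with ⟨rfl, -⟩ | ⟨rfl, -⟩
      · exact hFD _ hu'F haD
      · exact hFD _ hv' haD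
    · have hadj : (openGraph ((ω \ {e}) \ {e'})).Adj a c := (openGraph_adj _ _ _).2 ⟨⟨hac.1, hb⟩, hac.2⟩
      exact SimpleGraph.Reachable.trans ha hadj.reachable
  -- `F_{e'} ⊆ F_e`, contradicting `h2`
  obtain ⟨w, hwF', hwF⟩ := h2
  have hwC : w ∈ openCluster ω x := openCluster_mono Set.sdiff_subset x hwF'
  rcases hsplit hwC with hw | hw
  · exact hwF hw
  · -- `w ∈ D`: then `v ∈ F_{e'}`, and `F_{e'} ⊇ D` is infinite
    have hwv : w ∈ openCluster (ω \ {e'}) v :=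
      openCluster_mono (Set.sdiff_subset_sdiff_left Set.sdiff_subset) v (hD hw)
    have hvF' : v ∈ openCluster (ω \ {e'}) x := SimpleGraph.Reachable.trans hwF' (SimpleGraph.Reachable.symm hwv)
    have hDinf : (openCluster (ω \ {e}) v).Infinite :=
      (Set.infinite_union.1 (hinf.mono hsplit)).resolve_left he.not_infinite
    refine hDinf (he'.subset fun y hy => ?_)
    exact SimpleGraph.Reachable.trans hvF' (openCluster_mono (Set.sdiff_subset_sdiff_left Set.sdiff_subset) v (hD hy))

/-- **DISTINCT CUT-EDGES HAVE DISTINCT PIECES**: if `C_ω(x)` is infinite, `F_e = C_{ω∖{e}}(x)` is finite and `F_e = F_{e'}`, then `e = e'`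
(the far endpoint `v` of `e = {u,v}` would be joined to `x` in `ω ∖ {e'}` through `u` and the open edge `e ≠ e'`). [cite: Diestel2017, §3.3] -/
theorem cutPiece_injective (ω : BondConfig V) (x : V) (hinf : (openCluster ω x).Infinite) {e e' : Sym2 V}
    (he : (openCluster (ω \ {e}) x).Finite) (heq : openCluster (ω \ {e}) x = openCluster (ω \ {e'}) x) : e = e' := by
  by_contra hne
  obtain ⟨u, v, heuv, heω, huv, hu, hv⟩ := exists_crossing ω e x hinf he
  have he' : (openCluster (ω \ {e'}) x).Finite := heq ▸ he
  obtain ⟨u', v', he'uv, -, -, -, hv'⟩ := exists_crossing ω e' x hinf he'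
  -- `F_e` is reached from `x` avoiding both `e` and `e'`
  have hF : openCluster (ω \ {e}) x ⊆ openCluster ((ω \ {e}) \ {e'}) x := by
    refine TwoGhost.openCluster_subset_of_closed (mem_openCluster_self _ _) ?_
    intro a ha c hac
    rw [openGraph_adj] at hac
    have haF : a ∈ openCluster (ω \ {e}) x := openCluster_mono Set.sdiff_subset x ha
    have hcF : c ∈ openCluster (ω \ {e}) x := SimpleGraph.Reachable.trans haF ((openGraph_adj _ a c).2 hac).reachable
    by_cases hb : s(a, c) = e'
    · exfalso
      rw [he'uv, Sym2.eq_iff] at hb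
      rcases hb with ⟨-, rfl⟩ | ⟨rfl, -⟩
      · exact hv' (heq ▸ hcF)
      · exact hv' (heq ▸ haF)
    · have hadj : (openGraph ((ω \ {e}) \ {e'})).Adj a c := (openGraph_adj _ _ _).2 ⟨⟨hac.1, hb⟩, hac.2⟩
      exact SimpleGraph.Reachable.trans ha hadj.reachable
  -- hence `v ∈ F_{e'} = F_e`, absurd
  have huF' : u ∈ openCluster (ω \ {e'}) x := openCluster_mono (Set.sdiff_subset_sdiff_left Set.sdiff_subset) x (hF hu)
  have hadj : (openGraph (ω \ {e'})).Adj u v := (openGraph_adj _ _ _).2 ⟨⟨heuv ▸ heω, fun h => hne (heuv.trans h)⟩, huv⟩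
  have hvF' : v ∈ openCluster (ω \ {e'}) x := SimpleGraph.Reachable.trans huF' hadj.reachable
  exact hv (heq ▸ hvF')

/-- **A SMALLER CUT-EDGE LIES INSIDE THE BIGGER PIECE**: if `C_ω(x)` is infinite, `F_e` is finite and `F_e ⊄ F_{e'}`, then both endpoints of
`e'` lie in `F_e` (the path from `x` to a point of `F_e ∖ F_{e'}` avoiding `e` must use `e'`). [cite: Diestel2017, §3.3] -/
theorem mem_cutPiece_of_not_subset (ω : BondConfig V) (x : V) {e e' : Sym2 V}
    (h : ¬ openCluster (ω \ {e}) x ⊆ openCluster (ω \ {e'}) x) : ∀ y ∈ e', y ∈ openCluster (ω \ {e}) x := by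
  rw [Set.not_subset] at h
  obtain ⟨z, hzF, hzF'⟩ := h
  have hz2 : z ∉ openCluster ((ω \ {e}) \ {e'}) x := fun h' =>
    hzF' (openCluster_mono (Set.sdiff_subset_sdiff_left Set.sdiff_subset) x h')
  obtain ⟨u', v', he'uv, -, -, hu', -, hv'⟩ := exists_crossing_of_mem_of_not_mem (ω \ {e}) e' x hzF hz2
  intro y hy
  rw [he'uv, Sym2.mem_iff] at hy
  rcases hy with rfl | rfl
  · exact openCluster_mono Set.sdiff_subset x hu'
  · exact hv'

end Deterministic

/-! ## §2 Under the IIC: the cut-edges of the root form a strict chain -/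

variable {d : ℕ}

/-- **THE CUT-EDGES OF KESTEN'S IIC FORM A STRICT CHAIN, almost surely** (`d ≥ 1`, `0 < p`; every IIC probability measure): `ν`-a.s., for all
edges `e, e'` whose closing leaves the root in a finite cluster, the finite pieces are NESTED (`F_e ⊆ F_{e'}` or `F_{e'} ⊆ F_e`) and EQUAL ONLY IF
`e = e'` — with `…IICRecurrent` (infinitely many cut-edges) and `…IICBottlenecksCount` (`≥ (log_L N)/2` of them inside `Λ(N)` under UAD) this is
the 'string of beads' structure of the backbone. [cite: Kesten1986, §3] [cite: HeydenreichVanDerHofstad2017, §15.3] -/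
theorem iicMeasure_ae_cutPieces_chain (hd : 1 ≤ d) (p : unitInterval) (hp : 0 < (p : ℝ))
    {ν : Measure (BondConfig (Site d))} [IsProbabilityMeasure ν]
    (hν : ∀ (F : Finset (Sym2 (Site d))) (E : Set (BondConfig (Site d))), MeasurableSet E → DeterminedBy E ↑F →
      Tendsto (fun n : ℕ => (bondPercolation (zdGraph d) p).real (E ∩ siteToBoundary d n) / oneArmProb d p n)
        atTop (𝓝 (ν.real E))) :
    ∀ᵐ ω ∂ν, ∀ e e' : Sym2 (Site d), ω \ {e} ∉ percolatesAt (0 : Site d) → ω \ {e'} ∉ percolatesAt (0 : Site d) →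
      (openCluster (ω \ {e}) (0 : Site d) ⊆ openCluster (ω \ {e'}) 0 ∨ openCluster (ω \ {e'}) (0 : Site d) ⊆ openCluster (ω \ {e}) 0) ∧
      (openCluster (ω \ {e}) (0 : Site d) = openCluster (ω \ {e'}) 0 → e = e') := by
  filter_upwards [iicMeasure_ae_percolatesAt hd p hp hν] with ω hperc
  intro e e' he he'
  have hfe : (openCluster (ω \ {e}) (0 : Site d)).Finite := Set.not_infinite.1 he
  have hfe' : (openCluster (ω \ {e'}) (0 : Site d)).Finite := Set.not_infinite.1 he'
  exact ⟨cutPiece_subset_or_subset ω 0 hperc hfe hfe', fun heq => cutPiece_injective ω 0 hperc hfe heq⟩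


end Summit.CriticalPhenomena.PercolationContinuityZ3.Theorems.Crossing

end
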